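import Summits.CriticalPhenomena.PercolationContinuityZ3.Theorems.Transplant.CayleyZ2RotC4NoStepChart
import Summits.CriticalPhenomena.PercolationContinuityZ3.Theorems.Transplant.CayleyZ2RotC4SideStepsOrbits
import Summits.CriticalPhenomena.PercolationContinuityZ3.Theorems.Transplant.AutChartOrbitsCriticalContinuity
import HarnessLib

/-!
# The rotor square lattice `X = Cay(ℤ² ⋊ C₄; ρ, x)` meets EVERY hypothesis of the (N3-a) orbit theorem EXCEPT the single-edge steps — and that one fails for
# EVERY admissible choice: `p_c(X) < 1` (kernel, step-free), and `hstep` is refuted for every group of automorphisms, transversal, translated chart and scale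

builds on p205010 (kernel theorem, internal audit signed; external expert review pending) — nothing in this file uses p205010 (`p_c < 1` comes from p4 gen 25's step-free
«AutChartQuasiTransitive», the refutation from «CayleyZ2RotC4NoStepChart» p495173).  Lane `prim-bschramm`, seat `prim-bschramm-p5` gen 27 (refuter / sharpness seat;
P5-SHARPNESS §59 row 94).  Helper file (`--supports stmt-CriticalPhenomena-4575 --as helper`); no node / statement / `@[conjecture]`; `θ(p_c)` of `X` is NOT claimed (OPEN).

WHY.  The orbit theorem «AutChartOrbitsCriticalContinuity» `AutChart.criticalContinuity_of_autSubgroup_finite_orbits` (p3 g28, p493117) reads: `G` connected · `A ≤ Aut(G)` with a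
finite transversal `reps` (`htrans`, `hcover`) · a chart `φ : V → ℤ²` translated by `A` and constant on `reps` · a scale `N ≥ 1` with `N`-range bonds at `reps` · **`hstep`: exact
single-edge steps `± N eᵢ` at every representative** ⟹ `θ_v(p_c) = 0`.  This file shows on ONE graph that `hstep` is the load-bearing hypothesis and is NOT implied by the others:
* §1–§2 `X = Z2Rot.graph` is connected; the translation subgroup `T = ⟨Z2Rot.shiftIso u⟩ ≤ Aut(X)` has the transversal `Z2Rot.types` (FOUR orbits); the chart `Prod.fst` is translated by
  `T`, vanishes on the transversal, and has `1`-range bonds — every hypothesis but `hstep`, at `N = 1`;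
* §3 **`Z2Rot.rotor_criticalProb_lt_one : ∀ v, p_c(X) < 1`** — unconditional, by p4 gen 25's STEP-FREE `AutChart.criticalProb_lt_one_of_finite_orbits` (rank two from the translations by
  `e₀`, `e₁`); so `X` is a genuine instance of Benjamini–Schramm's question (quasi-transitive, `p_c < 1`);
* §4 **`Z2Rot.orbit_hstep_fails`**: for EVERY subgroup `A ≤ Aut(X)`, EVERY finite transversal `reps` covering `V` under `A`, EVERY chart `φ` translated by `A`, and EVERY `N ≠ 0`, the
  step hypothesis `hstep` at the representatives is FALSE — because translated steps at the representatives are steps everywhere, which «CayleyZ2RotC4NoStepChart»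
  `Z2Rot.no_singleEdgeStep_chart` forbids.  So no re-choice of symmetry group or chart rescues `X` for the orbit theorem; only a QUASI-step carrier can ((N3-b)).
[cite: BenjaminiSchramm1996, Conj. 4; §2 (quasi-transitive graphs, Conj. 1)] [cite: LyonsPeres2016, §7.4 Thm. 7.15] [this work]
-/

noncomputable section

namespace Summit.CriticalPhenomena.PercolationContinuityZ3.Theorems.Transplant

open MeasureTheory Literature.Probability.Percolation Literature.Probability.LatticeModels SimpleGraph
open scoped Classical

namespace Z2Rot

/-! ## §1 `X` is connected -/

/-- **Every vertex of `X` is joined to `((0,0), 0)`** (inside the height strip through it, p4 gen 19's `reachable_zero`). [folklore] -/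
theorem origin_reachable (a : Vtx) : graph.Reachable ((0 : Site 2), (0 : Fin 4)) a := by
  set ℓ : ℕ := (ψ a).natAbs + 1 with hℓ
  have ha : a ∈ stripSet ℓ := by
    rw [mem_stripSet]
    have : |ψ a| = ((ψ a).natAbs : ℤ) := (Int.natCast_natAbs (ψ a)).symm
    rw [this, hℓ]; push_cast; omega
  exact ((reachable_zero (by omega) a ha).map (Embedding.induce _).toHom).symm

/-- **`X` is connected** (every two vertices are joined through the origin). [folklore] -/
theorem rotor_reachable (a b : Vtx) : graph.Reachable a b := (origin_reachable a).symm.trans (origin_reachable b)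

/-- `X` is connected, as a `Connected` fact. [folklore] -/
theorem rotor_connected : graph.Preconnected ∧ graph.Connected :=
  ⟨rotor_reachable, (connected_iff _).2 ⟨rotor_reachable, ⟨((0 : Site 2), (0 : Fin 4))⟩⟩⟩

/-! ## §2 The translation subgroup of `Aut(X)`, its transversal, and the chart `Prod.fst` — every hypothesis of the orbit theorem but the steps -/

/-- Every element of `⟨shiftIso u : u ∈ ℤ²⟩ ≤ Aut(X)` is a translation of the position. [folklore] -/
theorem exists_shift_of_mem_transl {α : graph ≃g graph} (hα : α ∈ Subgroup.closure (Set.range shiftIso)) :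
    ∃ u : Site 2, ∀ (v : Site 2) (k : Fin 4), α (v, k) = (v + u, k) := by
  induction hα using Subgroup.closure_induction with
  | mem x hx =>
    obtain ⟨u, rfl⟩ := hx
    exact ⟨u, fun v k => rfl⟩
  | one => exact ⟨0, fun v k => by rw [RelIso.one_apply, add_zero]⟩
  | mul x y _ _ ihx ihy =>
    obtain ⟨u, hu⟩ := ihx
    obtain ⟨u', hu'⟩ := ihy
    exact ⟨u' + u, fun v k => by rw [RelIso.mul_apply, hu', hu, add_assoc]⟩
  | inv x _ ih =>
    obtain ⟨u, hu⟩ := ih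
    refine ⟨-u, fun v k => ?_⟩
    have h : x ((x⁻¹ (v, k)).1, (x⁻¹ (v, k)).2) = (v, k) := by rw [Prod.mk.eta, RelIso.apply_inv_self]
    rw [hu] at h
    obtain ⟨h1, h2⟩ := Prod.ext_iff.1 h
    refine Prod.ext ?_ h2
    show (x⁻¹ (v, k)).1 = v + -u
    rw [← sub_eq_add_neg, eq_sub_iff_add_eq]
    exact h1

/-- Pointwise form. [folklore] -/
theorem exists_shift_of_mem_transl' {α : graph ≃g graph} (hα : α ∈ Subgroup.closure (Set.range shiftIso)) :
    ∃ u : Site 2, ∀ w : Vtx, α w = (w.1 + u, w.2) ∧ True := by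
  obtain ⟨u, hu⟩ := exists_shift_of_mem_transl hα
  exact ⟨u, fun w => ⟨by obtain ⟨v, k⟩ := w; exact hu v k, trivial⟩⟩

/-- **THE ORBIT-THEOREM DATA OF `X` WITHOUT THE STEPS**: `Z2Rot.types` is a transversal of the translation subgroup (four orbits: transversal + cover), the chart `Prod.fst` is
translated by it and constant (`= 0`) on the transversal. [folklore] -/
theorem rotor_orbitData :
    (∀ r ∈ types, ∀ r' ∈ types, ∀ α ∈ Subgroup.closure (Set.range shiftIso), α r = r' → r = r') ∧
    (∀ w : Vtx, ∃ α ∈ Subgroup.closure (Set.range shiftIso), ∃ r ∈ types, α r = w) ∧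
    (∀ α ∈ Subgroup.closure (Set.range shiftIso), ∀ w : Vtx,
      (α w).1 = w.1 + ((α ((0 : Site 2), (0 : Fin 4))).1 - (((0 : Site 2), (0 : Fin 4)) : Vtx).1)) ∧
    (∀ r ∈ types, ∀ r' ∈ types, r.1 = r'.1) := by
  refine ⟨fun r hr r' hr' α hα h => ?_, fun w => ?_, fun α hα w => ?_, fun r hr r' hr' => ?_⟩
  · obtain ⟨u, hu⟩ := exists_shift_of_mem_transl' hα
    rw [(hu r).1] at h
    obtain ⟨-, h2⟩ := Prod.ext_iff.1 h
    exact Prod.ext (by rw [Z2RotSide.fst_eq_zero_of_mem_types hr, Z2RotSide.fst_eq_zero_of_mem_types hr']) h2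
  · exact ⟨shiftIso w.1, Subgroup.subset_closure ⟨w.1, rfl⟩, ((0 : Site 2), w.2), mem_types w.2, by
      show ((0 : Site 2) + w.1, w.2) = w
      rw [zero_add]⟩
  · obtain ⟨u, hu⟩ := exists_shift_of_mem_transl' hα
    rw [(hu w).1, (hu _).1]
    simp
  · rw [Z2RotSide.fst_eq_zero_of_mem_types hr, Z2RotSide.fst_eq_zero_of_mem_types hr']

/-- Along every bond the position changes by at most `1` in each coordinate (moves by a heading vector, turns by `0`). [folklore] -/
theorem abs_fst_sub_le {a b : Vtx} (h : graph.Adj a b) (i : Fin 2) : |b.1 i - a.1 i| ≤ ((1 : ℕ) : ℤ) := by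
  have hb := mem_nbrs_of_adj h
  simp only [nbrs, Finset.mem_insert, Finset.mem_singleton] at hb
  obtain ⟨v, k⟩ := a
  rw [Nat.cast_one]
  rcases hb with rfl | rfl | rfl | rfl
  · simpa using Z2RotSide.abs_dir_le k i
  · simpa using Z2RotSide.abs_dir_le k i
  · simp
  · simp

/-- `1`-range bonds at the base vertices of the ROTOR lattice (the `hlip` hypothesis of the orbit theorem at `N = 1`). [folklore] -/
theorem rotor_lip_types (r : Vtx) (_hr : r ∈ types) (w : Vtx) (h : graph.Adj r w) (i : Fin 2) : |w.1 i - r.1 i| ≤ ((1 : ℕ) : ℤ) :=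
  abs_fst_sub_le h i

/-! ## §3 `p_c(X) < 1`, step-free -/

/-- **`p_c(X) < 1` at every vertex of the rotor square lattice** — by p4 gen 25's STEP-FREE `AutChart.criticalProb_lt_one_of_finite_orbits` on the translation subgroup (four orbits,
chart character of `Prod.fst`, rank two from the translations by `e₀` and `e₁`).  No `θ(p_c)` statement. [cite: BenjaminiSchramm1996, §2 Conj. 1] [cite: LyonsPeres2016, §7.4 Thm. 7.15] -/
theorem rotor_criticalProb_lt_one : ∀ v : Vtx, criticalProb graph v < 1 := by
  intro v
  letI : MulAction (graph ≃g graph) Vtx := AutChart.autMulAction graph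
  have hact : IsActionByAut graph (Subgroup.closure (Set.range shiftIso)) := fun a x y => (a : graph ≃g graph).map_rel_iff'
  have hφ : ∀ (a : Subgroup.closure (Set.range shiftIso)) (w : Vtx),
      (a • w).1 = w.1 + ((a • (((0 : Site 2), (0 : Fin 4)) : Vtx)).1 - (((0 : Site 2), (0 : Fin 4)) : Vtx).1) :=
    fun a w => rotor_orbitData.2.2.1 a a.2 w
  have hval : ∀ (a : Subgroup.closure (Set.range shiftIso)) (u : Site 2), (∀ w : Vtx, (a : graph ≃g graph) w = (w.1 + u, w.2)) →
      Multiplicative.toAdd (AutChart.chartHom _ Prod.fst hφ a) = u := fun a u hu => by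
    rw [AutChart.toAdd_chartHom]
    show ((a : graph ≃g graph) ((0 : Site 2), (0 : Fin 4))).1 - (0 : Site 2) = u
    rw [hu, sub_zero]
    exact zero_add u
  refine AutChart.criticalProb_lt_one_of_finite_orbits hact rotor_connected.2 (((0 : Site 2), (0 : Fin 4)) : Vtx) types
    (fun w => by obtain ⟨α, hα, r, hr, hw⟩ := rotor_orbitData.2.1 w; exact ⟨⟨α, hα⟩, r, hr, hw⟩) (AutChart.chartHom _ Prod.fst hφ) (fun h hh => ?_) ?_ v
  · show Multiplicative.ofAdd ((h • (((0 : Site 2), (0 : Fin 4)) : Vtx)).1 - (((0 : Site 2), (0 : Fin 4)) : Vtx).1) = 1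
    rw [MulAction.mem_stabilizer_iff.1 hh, sub_self, ofAdd_zero]
  · refine ⟨⟨shiftIso (dir 0), Subgroup.subset_closure ⟨dir 0, rfl⟩⟩, ⟨shiftIso (dir 1), Subgroup.subset_closure ⟨dir 1, rfl⟩⟩, ?_⟩
    rw [hval _ (dir 0) (fun w => rfl), hval _ (dir 1) (fun w => rfl)]
    simp [MaxArea.det2, dir]

/-! ## §4 The step hypothesis fails for EVERY admissible choice on `X` -/

/-- **`hstep` OF THE ORBIT THEOREM FAILS ON `X` FOR EVERY SYMMETRY GROUP, TRANSVERSAL, TRANSLATED CHART AND SCALE.**  If `A ≤ Aut(X)` covers `V` from `reps` and translates the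
chart `φ`, then exact single-edge steps `± N eᵢ` at the representatives (`N ≠ 0`) are impossible: they would transport to every vertex (automorphisms preserve adjacency and shift
`φ` by a constant), contradicting «CayleyZ2RotC4NoStepChart» `Z2Rot.no_singleEdgeStep_chart`. [this work] -/
theorem orbit_hstep_fails (A : Subgroup (graph ≃g graph)) (reps : Finset Vtx) (hcover : ∀ w : Vtx, ∃ α ∈ A, ∃ r ∈ reps, α r = w)
    (φ : Vtx → Site 2) {t : Vtx} (hφ : ∀ α ∈ A, ∀ w : Vtx, φ (α w) = φ w + (φ (α t) - φ t)) (N : ℤ) (hN : N ≠ 0)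
    (hstep : ∀ r ∈ reps, ∀ (i : Fin 2) (σ : ℤˣ), ∃ w : Vtx, graph.Adj r w ∧ φ w = φ r + Pi.single i (N * (σ : ℤ))) : False := by
  refine no_singleEdgeStep_chart N hN φ fun v i σ => ?_
  obtain ⟨α, hα, r, hr, rfl⟩ := hcover v
  obtain ⟨w, hw, hφw⟩ := hstep r hr i σ
  refine ⟨α w, (α.map_rel_iff').2 hw, ?_⟩
  rw [hφ α hα w, hφ α hα r, hφw]
  abel

/-- … in particular with the orbit theorem's `ℕ`-scale `N ≥ 1` and its literal `hstep` shape. [this work] -/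
theorem orbit_hstep_fails_nat (A : Subgroup (graph ≃g graph)) (reps : Finset Vtx) (hcover : ∀ w : Vtx, ∃ α ∈ A, ∃ r ∈ reps, α r = w)
    (φ : Vtx → Site 2) {t : Vtx} (hφ : ∀ α ∈ A, ∀ w : Vtx, φ (α w) = φ w + (φ (α t) - φ t)) (N : ℕ) (hN : 1 ≤ N)
    (hstep : ∀ r ∈ reps, ∀ (i : Fin 2) (σ : ℤˣ), ∃ w : Vtx, graph.Adj r w ∧ φ w = φ r + Pi.single i ((N : ℤ) * σ)) : False :=
  orbit_hstep_fails A reps hcover φ hφ (N : ℤ) (by exact_mod_cast (show N ≠ 0 by omega)) hstep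

/-- **SUMMARY: on `X` the orbit theorem's hypothesis list minus `hstep` is satisfiable (translations, four orbits, chart `Prod.fst`, `N = 1`) while `hstep` is refuted for every
choice** — the single-edge step field is exactly what separates `X` from the theorem. [this work] -/
theorem inputs_but_step :
    graph.Connected ∧
    (∀ r ∈ types, ∀ r' ∈ types, ∀ α ∈ Subgroup.closure (Set.range shiftIso), α r = r' → r = r') ∧
    (∀ w : Vtx, ∃ α ∈ Subgroup.closure (Set.range shiftIso), ∃ r ∈ types, α r = w) ∧
    (∀ α ∈ Subgroup.closure (Set.range shiftIso), ∀ w : Vtx,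
      (α w).1 = w.1 + ((α ((0 : Site 2), (0 : Fin 4))).1 - (((0 : Site 2), (0 : Fin 4)) : Vtx).1)) ∧
    (∀ r ∈ types, ∀ r' ∈ types, r.1 = r'.1) ∧
    (∀ r ∈ types, ∀ w : Vtx, graph.Adj r w → ∀ i : Fin 2, |w.1 i - r.1 i| ≤ ((1 : ℕ) : ℤ)) ∧
    ¬ (∀ r ∈ types, ∀ (i : Fin 2) (σ : ℤˣ), ∃ w : Vtx, graph.Adj r w ∧ w.1 = r.1 + Pi.single i (((1 : ℕ) : ℤ) * σ)) :=
  ⟨rotor_connected.2, rotor_orbitData.1, rotor_orbitData.2.1, rotor_orbitData.2.2.1, rotor_orbitData.2.2.2, rotor_lip_types,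
    fun h => orbit_hstep_fails_nat (Subgroup.closure (Set.range shiftIso)) types rotor_orbitData.2.1 Prod.fst (t := ((0 : Site 2), (0 : Fin 4)))
      rotor_orbitData.2.2.1 1 le_rfl h⟩

end Z2Rot

end Summit.CriticalPhenomena.PercolationContinuityZ3.Theorems.Transplant

end
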